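import Summits.ResolutionOfSingularities.ResolutionOfSingularities.Theorems.WeightedInvariantIota3TauDescentCaseB
import Summits.ResolutionOfSingularities.ResolutionOfSingularities.Theorems.WeightedInvariantIota3TauStrat
import Summits.ResolutionOfSingularities.ResolutionOfSingularities.Theorems.WeightedInvariantIota3EpsStrat
import HarnessLib

/-!
# In the CURVE regime the Abramovich–Quek–Schober datum is TIE-FREE for its own weights
# (door `HypersurfaceCentreConstruction`, stmt-ResolutionOfSingularities-19897; residual (D-b³-curve-TIE) of `stub_keyRungGrHomLE_three`)

Helper for `stub_keyRungGrHomLE_three` (def-free, `--supports 19897`).  Companion of hand -8's …Iota3DropCurveAQSDatum (the AQS germ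
`(y/1, x/1; r, q; rν)` of `f/1` at the canonical curve centre `P = (x, y)` is presented by a regular system of parameters `(x, y, z)` of `S`)
and of …KeyRungThreeOfDropCurveTie (gap list hD + (D-b³-point) + (D-b³-curve-TIE)).

* **`Iota3.not_mem_tie_of_curve_lexMax`** — `S` regular local, `ringKrullDim S = 3`, `0 ≠ f ∈ 𝔪`; `P = (x, y) ≠ 𝔪` prime with
  `topStratum ι₀ S f = V(P)`, `¬ dim S_P ≤ 1`, `dim S ⧸ P = 1`; `(x, y, z)` a regular system of parameters; `f ∈ 𝔪^ν ∖ 𝔪^{ν+1}`; `(y/1, x/1; r, q; rν)`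
  lex-maximal for `(f/1) ⊆ S_P`.  Then for EVERY `λ ∈ S`: `f ∉ 𝒥_{(r+1)ν}((x, y − λx^r, z); (q, r+1, 1))`.  Otherwise
  `(x, y, z; q, r; λ)` is a TIE PRESENTATION (`IsTiePresentation`): `ε(S, f) = 0` because `ι₀` is constant along `V(P)` and `ε = 0` at the
  surface germ `S_P` (`iotaEps_eq_zero_of_ringKrullDim_le_two`); `P₀(ν ; ε) = P` off tie positions
  (`topStratumPrime_iotaOrdEpsTau_eq_of_not_isTiePosition`); so `(S, f)` would be a TIE POSITION and the top `ι₀`-stratum the closed point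
  (`topStratumPrime_iotaOrdEpsTau_eq_maximalIdeal_of_isTiePosition`), against `P ≠ 𝔪`.
* **`Iota3.not_mem_tie'_of_curve_lexMax`** — for `q = r` (`= 1`) also `f ∉ 𝒥_{2ν}((y, x, z); (1, 2, 1))` (the same with `x ↔ y`, `λ = 0`,
  `IsLexMaxWeightedCentreGerm.swap_one_one`).

CONSEQUENCE (CURVE-TIE.md §3).  When the AQS slope `r/q` of `f/1` is an INTEGER (`q = 1`, `r = b = b_max`) these are exactly the inputs
`htie` / `htie'` of hand -7's `Iota3.dropb3_curve_of_tieFree_datum` for the AQS-adapted datum of …Iota3DropCurveAQSDatum: the ORDER drops at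
every successor over `𝔪` and (D-b³-curve) holds there; the residual (D-b³-curve-TIE) lives only at curve centres with FRACTIONAL AQS slope
(`q ≥ 2`), where the integer-contact datum of `J₃ᵗ` can be tied (`f = y² + z x³`) and `σ₁` must carry the drop.
[OURS · L1 W4.3 · audit glue; AI work, weaker than expert review; nothing here is a statement of the manuscript under review.]

## References

* D. Abramovich, M. H. Quek, B. Schober, arXiv:2507.01232 (2025), Thm 1.3 (3), Thm 3.5. [AbramovichQuekSchober2025]
* H. Matsumura, *Commutative Ring Theory* (1987), §5. [Matsumura1987]
-/

noncomputable section

set_option linter.dupNamespace false -- mandated namespace of this single-conjunct summit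

open IsLocalRing Literature.AlgebraicGeometry.Resolution
open Summit.ResolutionOfSingularities.ResolutionOfSingularities.Theorems
open Summit.ResolutionOfSingularities.ResolutionOfSingularities.Theorems.ContactCylinder

namespace Summit.ResolutionOfSingularities.ResolutionOfSingularities.Cruxes.HypersurfaceCentreConstruction.LocalEngine

namespace Iota3

/-- **In the curve regime the AQS datum is tie-free** (see the module docstring). [OURS · L1 W4.3 · (D-b³-curve-TIE) tool]
[cite: AbramovichQuekSchober2025, Thm 1.3 (3), Thm 3.5] -/
theorem not_mem_tie_of_curve_lexMax {S : Type} [CommRing S] [IsRegularLocalRing S] (hd : ringKrullDim S = 3)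
    {f : S} (hf0 : f ≠ 0) (hf : f ∈ maximalIdeal S) (P : Ideal S) [hP : P.IsPrime]
    (hE : topStratum iotaOrdEpsTau S f = {𝔮 | P ≤ 𝔮.asIdeal}) (hP1 : ¬ ringKrullDim (Localization.AtPrime P) ≤ 1)
    (hPm : P ≠ maximalIdeal S) (hq1 : ringKrullDim (S ⧸ P) = 1)
    {x y z : S} (hPeq : Ideal.span ({x, y} : Set S) = P) (hxyz : Ideal.span {x, y, z} = maximalIdeal S) {q r ν : ℕ}
    (hfν : f ∈ maximalIdeal S ^ ν) (hfν1 : f ∉ maximalIdeal S ^ (ν + 1))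
    (hlex : IsLexMaxWeightedCentreGerm (Localization.AtPrime P) (Ideal.span {algebraMap S (Localization.AtPrime P) f})
      ![algebraMap S (Localization.AtPrime P) y, algebraMap S (Localization.AtPrime P) x] ![r, q] (r * ν)) (lam : S) :
    f ∉ weightedMonomialIdeal ![x, y - lam * x ^ r, z] ![q, r + 1, 1] ((r + 1) * ν) := by
  subst hPeq
  intro hmem
  haveI : IsDomain S := isDomain_of_isRegularLocalRing S
  have hdle : ringKrullDim S ≤ 3 := le_of_eq hd
  have hν : iotaOrd S f = ν := (iotaOrd_eq_natCast_iff S f ν).mpr ⟨hfν, hfν1⟩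
  have hP₀ : topStratumPrime iotaOrdEpsTau S f = Ideal.span {x, y} :=
    ContactCylinder.topStratumPrime_eq_of_topStratum_eq iotaOrdEpsTau S f hE
  have hntie : ¬ IsTiePosition S f := fun ht =>
    hPm (hP₀.symm.trans (topStratumPrime_iotaOrdEpsTau_eq_maximalIdeal_of_isTiePosition ht))
  have hP₀' : topStratumPrime iotaOrdEps S f = Ideal.span {x, y} :=
    (topStratumPrime_iotaOrdEpsTau_eq_of_not_isTiePosition hdle hntie).symm.trans hP₀
  -- `ε(S, f) = 0`: `ι₀` is constant along `V(P)` and `ε = 0` at the surface germ `S_P`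
  obtain ⟨_, -, hfP, -, -, -⟩ := topStratumPrime_iotaOrdEpsTau_spec hdle hf0 hf hν
  rw [hP₀] at hfP
  have hmemTop : (⟨Ideal.span {x, y}, hP⟩ : PrimeSpectrum S) ∈ topStratum iotaOrdEpsTau S f := by
    rw [hE]; exact (le_rfl : Ideal.span {x, y} ≤ Ideal.span {x, y})
  have h0 : iotaOrdEpsTau (Localization.AtPrime (Ideal.span ({x, y} : Set S)))
      (algebraMap S (Localization.AtPrime (Ideal.span ({x, y} : Set S))) f) = iotaOrdEpsTau S f := hmemTop
  have hεeq := ((iotaOrdEps_eq_iff _ _ _ _).mp ((iotaOrdEpsTau_eq_iff _ _ _ _).mp h0).1).2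
  haveI : IsRegularLocalRing (Localization.AtPrime (Ideal.span ({x, y} : Set S))) :=
    isRegularLocalRing_localization_atPrime S _
  have hdimP : ringKrullDim (Localization.AtPrime (Ideal.span ({x, y} : Set S))) ≤ 2 :=
    ringKrullDim_localization_le_two_of_ne hdle _ hPm
  have hf0' : algebraMap S (Localization.AtPrime (Ideal.span ({x, y} : Set S))) f ≠ 0 := fun h =>
    hf0 ((injective_iff_map_eq_zero _).mp
      (IsLocalization.injective (Localization.AtPrime (Ideal.span ({x, y} : Set S)))
        (Ideal.span ({x, y} : Set S)).primeCompl_le_nonZeroDivisors) f h)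
  have hf' : algebraMap S (Localization.AtPrime (Ideal.span ({x, y} : Set S))) f ∈
      maximalIdeal (Localization.AtPrime (Ideal.span ({x, y} : Set S))) :=
    (IsLocalization.AtPrime.to_map_mem_maximal_iff _ (Ideal.span ({x, y} : Set S)) f).mpr hfP
  have hε : iotaEps S f = 0 := by
    rw [← hεeq]; exact iotaEps_eq_zero_of_ringKrullDim_le_two hdimP hf0' hf'
  -- `dim S ⧸ P₀(ν ; ε) = 1`
  have hcongr : ∀ I J : Ideal S, I = J → ringKrullDim (S ⧸ I) = ringKrullDim (S ⧸ J) := by rintro I J rfl; rfl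
  have hq1' : ringKrullDim (S ⧸ topStratumPrime iotaOrdEps S f) = 1 := by rw [hcongr _ _ hP₀']; exact hq1
  -- the tie presentation
  exact hntie ⟨inferInstance, hd, hε, hq1', x, y, z, q, r, lam, hxyz, hP₀', ν, hP, hfν, hfν1, hlex, hmem⟩

/-- **The `q = r` companion** (`x ↔ y`, `λ = 0`): `f ∉ 𝒥_{2ν}((y, x, z); (1, 2, 1))` when the lex-maximal weights are `(1, 1)`.
[OURS · L1 W4.3 · (D-b³-curve-TIE) tool] [cite: AbramovichQuekSchober2025, Thm 3.5] -/
theorem not_mem_tie'_of_curve_lexMax {S : Type} [CommRing S] [IsRegularLocalRing S] (hd : ringKrullDim S = 3)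
    {f : S} (hf0 : f ≠ 0) (hf : f ∈ maximalIdeal S) (P : Ideal S) [hP : P.IsPrime]
    (hE : topStratum iotaOrdEpsTau S f = {𝔮 | P ≤ 𝔮.asIdeal}) (hP1 : ¬ ringKrullDim (Localization.AtPrime P) ≤ 1)
    (hPm : P ≠ maximalIdeal S) (hq1 : ringKrullDim (S ⧸ P) = 1)
    {x y z : S} (hPeq : Ideal.span ({x, y} : Set S) = P) (hxyz : Ideal.span {x, y, z} = maximalIdeal S) {ν : ℕ}
    (hfν : f ∈ maximalIdeal S ^ ν) (hfν1 : f ∉ maximalIdeal S ^ (ν + 1))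
    (hlex : IsLexMaxWeightedCentreGerm (Localization.AtPrime P) (Ideal.span {algebraMap S (Localization.AtPrime P) f})
      ![algebraMap S (Localization.AtPrime P) y, algebraMap S (Localization.AtPrime P) x] ![1, 1] (1 * ν)) :
    f ∉ weightedMonomialIdeal ![y, x, z] ![1, 2, 1] (2 * ν) := by
  have hPeq' : Ideal.span ({y, x} : Set S) = P := by rw [Ideal.span_pair_comm]; exact hPeq
  have hyxz : Ideal.span {y, x, z} = maximalIdeal S := by rw [Set.insert_comm]; exact hxyz
  have h := not_mem_tie_of_curve_lexMax hd hf0 hf P hE hP1 hPm hq1 hPeq' hyxz hfν hfν1 (IsLexMaxWeightedCentreGerm.swap_one_one hlex) 0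
  have h2 : (1 + 1 : ℕ) = 2 := rfl
  rw [zero_mul, sub_zero, h2] at h
  exact h

end Iota3

end Summit.ResolutionOfSingularities.ResolutionOfSingularities.Cruxes.HypersurfaceCentreConstruction.LocalEngine

end
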